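import Literature.MathematicalPhysics.QuantumFieldTheory.Balaban1983to89.B9Thm313WholeCutLettersL2From3152
import Literature.MathematicalPhysics.QuantumFieldTheory.Balaban1983to89.B9PerturbationMajorantsAtLettersPhys
import Literature.MathematicalPhysics.QuantumFieldTheory.Balaban1983to89.B9Eq346GradGpDivAtPinsL2Closed
import Literature.MathematicalPhysics.QuantumFieldTheory.Balaban1983to89.B9RWSums347DefiniteFaces
import Literature.MathematicalPhysics.QuantumFieldTheory.Balaban1983to89.B9RWSumsDefinitePins
import Literature.MathematicalPhysics.QuantumFieldTheory.Balaban1983to89.B9CoReadingCoordsTranspose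
import Literature.MathematicalPhysics.QuantumFieldTheory.Balaban1983to89.B9Thm311SymmAtRecordV4
import Literature.MathematicalPhysics.QuantumFieldTheory.Balaban1983to89.B9Thm311AdjointPairs
import Literature.MathematicalPhysics.QuantumFieldTheory.Balaban1983to89.B9Thm37GlueTorusCov
import Literature.MathematicalPhysics.QuantumFieldTheory.Balaban1983to89.B9CoReadingCoordsH
import Literature.MathematicalPhysics.QuantumFieldTheory.Balaban1983to89.B9Thm313WholeDirL2Z

/-!
# BalabanUVNodes ∕ N06 ([B9], `Dag.B9_main`) — THE TWO RE-CUT BLOCK-L² LETTERS `vDRDG ∕ vGDRD` (D·R·D*·G₁ and G₁·D·R·D*) OF ROWS 20–21's `Letters313L2Pc` AT def-Y's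
# MEMBERS OF RECORD, FROM THE IDENTITY (3.152) AT THE KNIT's SITE MODEL `GcoS … (GpY …)` (= print's G′ in print's units) — the member-∀ knit of dag-n06-l's
# `B9Thm313WholeCutLettersL2From3152.vDRDG_of_ids3152 ∕ vGDRD_of_ids3152` with the certificate's derived Theorem 3.1 ∕ (3.49) ∕ (3.46)₄ material

Track A of `YM-PLAN.md` (cell `pub-ymgap`, HUMAN RULING D-0062), node **N06** = [Balaban1985BackgroundPropagators] Thms 3.1–3.15; seat `pub-ymgap-dag-n06-d`
(s2, «knit N06 at the ₁₁ record»), gen 12.  A HELPER for the stage-11 certificate editions ≥ 39.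

WHAT.  Edition 38 (`…V6EPairNS`) displays rows 20–21's re-cut block-L² schema `hLL2 : … → Letters313L2Pc (𝔬12 x) (𝔡A x).Dd (𝔡A x).Dsd 1 (H x) B13₄ δ12₃ (vZ x) (hvZ x) U ∧ …`
(dag-n06-l g19 `B9Thm313WholeLettersCut`), whose two NEW letters — `vDRDG` (D·R·D\*·G₁) and `vGDRD` (G₁·D·R·D\*) in block-L² with the len-ratio factors — dag-n06-l's
`B9Thm313WholeCutLettersL2From3152` (p634014) derives at the schema level from: the identity (3.152) `Ids3152 𝔬 Gp U` (`RD\*G₁ = RG′D\*`, `G₁DR = DG′R`, p. 426), `R = ϱ(I − P)`,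
Theorem 3.1 for G′ (`Thm31GpMaj`), (3.49) (`Proj349Maj`), the block-L² line (3.46)₄ of DG′D\*, the transposition letters (G′, P symmetric; (D)ᵀ = D\*), the member facts and [4] (2.61).
THE UNITS POINT (node00-def-Y LOCATED-152, bus 2026-08-28): the certificate's Sect.-D letters `G₁ ∕ R` are built on the PRINT-UNITS site propagator `GpPhysY = etaS² • GpY`
(`Node00/OpsYGpUnits`, `OpsYRecordV4P`), and the knit's site coordinate model ALREADY CARRIES that factor — `GcoS … O U := (etaS²·cR39 b) • coordOpK b (fun _ => O (cfg U))`
(`B9CoReadingCoordsS` :177) — so the G′ of (3.152) next to them is `Gp x U := GcoS x.toKIdx (trBasis N) (bg9Y …) (fun U => U) (GpY x.toKIdx (parSymY x.toKIdx)) U` (= `cR39 • coordOpK (GpPhysY U)`;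
dimension check `D\*G₁ ~ η ~ G′D\*` by def-Y), which is EXACTLY the letter the certificate's DERIVED Theorem 3.1 (`thm31GpMaj_of_t37_pairM`), (3.49) (`proj349Maj_of_t37_display348_rate`,
`PcoK … (GpY …)`) and dag-n06-w7's CLOSED (3.46)₄ line (`blockBd_DvGcoSDvs_memberY_at`) are about — NO units transfer; `R` does not see the factor (`rcoK_GpPhysY`, `rcoK_eq`).
THIS FILE does that once, member-∀, in the certificate's binder shape:
`letters313L2MZ_mono_const` (constant UP for the direction-indexed pair letters); ★★ `vDRDG_vGDRD_of_pins` — inputs: the pins `hlev hβ1 hblk12 hblkW12 hDvco12 hDvsco12 hRco12`; the certificate's derived families `h31` (Thm 3.1 at `GcoS(GpY)`), `h49` ((3.49)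
at `PcoK(GpY)`), `h46` ((3.46)₄ at `DvcoKH ∘ GcoS(GpY) ∘ DvscoKH`, dag-n06-w7's constants `B46 δ46`), all restricted to one regime (M₁, a₁) under (3.35); the DISPLAYED identity
(3.152) family `h152` at the print-units letter; numerics: `q : PinPrims` (for the exponents α, α_F of the member facts), the T-step rate `rT` with `2σS ≤ rT ≤ min(δ31, δP, δ46)`,
and the ONE rate inequality the edition displays, `hδ₃ : δ₃ ≤ (1 − 2·q.αF)·rT − σS`.  Output: `∃ (Mc B₄ : ℝ), M₁ ≤ Mc ∧ B₄₀ ≤ B₄ ∧ ∀ x, Mc ≤ M_x → ∀ α₀ > 0, M_xα₀ ≤ a₁ → ∀ U, Reg335 →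
Reg336 → vDRDG-statement ∧ vGDRD-statement` at (B₄, δ₃) for `(𝔬12 x)`'s letters, `B₄ ≥ B₄₀` (the displayed constant of the kept letters, which the
edition lifts to `B₄` by `Letters313L2Pk.mono` ∕ `letters313L2MZ_mono_const`) — exactly the two arguments of `B9Thm313WholeLettersCutKept.Letters313L2Pc.of_kept`.
Member facts at the rate `rT` (`lemma21Pack_geo9Y` at `δ₀ := rT∕(1 − 2α)`), row sum at `σS` (`rowSum261_geo9Y`); transposes as in `N06StepL2AtPinsPhys` (`isTransposePair_GcoS_trBasis` +
`GpY_isSymmTr ∘ symm0_parSymY`, `isTransposePair_DvcoKH_DvscoKH`, `isTransposePair_RcoK` + `rcoK_eq`).  (3.152) itself at curved U is NOT a def-Y theorem: with `Ids3124` it reduces to print's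
p. 426 remark «QG₁DR = QDG′R = D₁Q′G′R = 0» = the (3.115)-class located gap O5 (def-Y INTENT-52) — it stays DISPLAYED.
HONEST FRAMING.  Kernel bookkeeping (two applications of dag-n06-l's theorems per member and configuration, one units rescaling); COUNT-NEUTRAL; nothing of [B9] asserted —
Theorem 3.1, (3.49), (3.46)₄ enter as the certificate's DERIVED families (displayed here as hypotheses), (3.152) as its DISPLAYED identity; N06 NOT discharged.  One finite 𝕋⁴ programme
at fixed `ε` — NOT continuum, NOT OS, NOT the mass gap ∕ Clay.  0 `def`, 0 `sorry`.
-/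

noncomputable section

namespace Summit.QuantumFields.YangMills.BalabanUVNodes.N06CutL2LettersAtPinsPhys

open Literature.MathematicalPhysics.QuantumFieldTheory.Balaban1983to89
open Literature.MathematicalPhysics.QuantumFieldTheory.Balaban1983to89.Node00 (FBondY IBondY CfgY GpY GpPhysY parSymY)
open Literature.MathematicalPhysics.QuantumFieldTheory.Balaban1983to89.Node00.OpsYSectDCoords (DvcoKH DvscoKH RcoK isTransposePair_DvcoKH_DvscoKH isTransposePair_RcoK cR39_trBasis_pos)
open Literature.MathematicalPhysics.QuantumFieldTheory.Balaban1983to89.B9Thm34Ext (toB6)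
open Literature.MathematicalPhysics.QuantumFieldTheory.Balaban1983to89.B11SectG (BlockNorm HasMaj RowSum)
open Literature.MathematicalPhysics.QuantumFieldTheory.Balaban1983to89.B9SectDL2Decay (BlockBd)
open Literature.MathematicalPhysics.QuantumFieldTheory.Balaban1983to89.B9Thm37Glue (IsTransposePair isTransposePair_one)
open Literature.MathematicalPhysics.QuantumFieldTheory.Balaban1983to89.B9Thm37GlueTorusCov (isTransposePair_smul)
open Literature.MathematicalPhysics.QuantumFieldTheory.Balaban1983to89.B9Thm312Whole (GeoOK)
open Literature.MathematicalPhysics.QuantumFieldTheory.Balaban1983to89.B9RWSums343to347Whole (Facts347)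
open Literature.MathematicalPhysics.QuantumFieldTheory.Balaban1983to89.B9RWSumsDefinitePins (PinPrims)
open Literature.MathematicalPhysics.QuantumFieldTheory.Balaban1983to89.B9RWSums347DefiniteFaces (exp261 lemma21Pack_geo9Y)
open Literature.MathematicalPhysics.QuantumFieldTheory.Balaban1983to89.B9PinMembersKLevelV1 (MemberY geo9Y bg9Y)
open Literature.MathematicalPhysics.QuantumFieldTheory.Balaban1983to89.B9GeoLemma21KLevelV1 (geo9Y_len_pos geo9Y_dist_triangle geo9Y_dist_comm rowSum261_geo9Y)
open Literature.MathematicalPhysics.QuantumFieldTheory.Balaban1983to89.B9GeoNormsKLevelV1 (geo9K_dist_nonneg)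
open Literature.MathematicalPhysics.QuantumFieldTheory.Balaban1983to89.B7Prop2SpecialUnitary (specialUnitaryUnits specialUnitaryUnits_le_unitaryUnits)
open Literature.MathematicalPhysics.QuantumFieldTheory.Balaban1983to89.B9CoReadingCoords (XBK blkBK)
open Literature.MathematicalPhysics.QuantumFieldTheory.Balaban1983to89.B9CoReadingCoordsH (XHK)
open Literature.MathematicalPhysics.QuantumFieldTheory.Balaban1983to89.B9CoReadingCoordsS (XSK GcoS blkSK sIK)
open Literature.MathematicalPhysics.QuantumFieldTheory.Balaban1983to89.B9CoReadingCoordsTranspose (TrIdx trBasis isTransposePair_GcoS_trBasis)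
open Literature.MathematicalPhysics.QuantumFieldTheory.Balaban1983to89.B9Thm39ReadingCoords (cR39 cR39_nonneg)
open Literature.MathematicalPhysics.QuantumFieldTheory.Balaban1983to89.B9PerturbationMajorantAlgebra (Thm31GpMaj Proj349Maj)
open Literature.MathematicalPhysics.QuantumFieldTheory.Balaban1983to89.B9PerturbationMajorantsAtLetters (PcoK rcoK_eq)
open Literature.MathematicalPhysics.QuantumFieldTheory.Balaban1983to89.B9PerturbationMajorantsAtLettersPhys (rcoK_GpPhysY)
open Literature.MathematicalPhysics.QuantumFieldTheory.Balaban1983to89.B9Thm311AdjointPairs (GpY_isSymmTr)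
open Literature.MathematicalPhysics.QuantumFieldTheory.Balaban1983to89.B9Thm311SymmAtRecordV4 (symm0_parSymY)
open Literature.MathematicalPhysics.QuantumFieldTheory.Balaban1983to89.B9Thm313WholeRgdFrom3152 (Ids3152)
open Literature.MathematicalPhysics.QuantumFieldTheory.Balaban1983to89.B9Thm313WholeDirL2Z (Letters313L2MZ)
open Literature.MathematicalPhysics.QuantumFieldTheory.Balaban1983to89.B9Thm313WholeCutLettersL2From3152 (vDRDG_of_ids3152 vGDRD_of_ids3152)
open Literature.MathematicalPhysics.QuantumFieldTheory.Balaban1983to89.B9Eq346GradGpDivAtPinsL2Closed (B46 δ46 B46_pos)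
open Literature.MathematicalPhysics.QuantumFieldTheory.Balaban1983to89.B6GlobalChartV1 (blkV1)
open Literature.MathematicalPhysics.QuantumFieldTheory.Balaban1983to89.B6Ineq2142KLevelV1 (β lvl)
open Literature.MathematicalPhysics.QuantumFieldTheory.Balaban1983to89.B6Geom246MultiLevelTorus (geomT)
open scoped Matrix.Norms.L2Operator

variable {N : ℕ} [NeZero N]
variable {d ℓ : ℕ} {hd : 1 ≤ d + 1} {hL : Odd (ℓ + 1) ∧ 1 < ℓ + 1} {b₀ b₁ : ℝ} {Mstar : ℕ}
variable [∀ x : MemberY d ℓ hd hL b₀ b₁ Mstar, Fintype (geo9Y x).Site]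

/-- the direction-indexed block-L² letters `Letters313L2MZ` at a LARGER constant (`B₄ ≤ B₄′`; the rate twin is dag-n06-l's `letters313L2MZ_mono`) — the edition's device for
meeting the constant at which the re-cut letters are supplied. [cite: Balaban1985BackgroundPropagators, (3.46) p.398 (bookkeeping); Balaban1984PropagatorsII, (2.51)–(2.54) p.232] -/
theorem letters313L2MZ_mono_const {g : B9.Geometry} {B : B9.Backgrounds} {X Y Z W P : Type} [Fintype X] [Fintype Y] [Fintype Z] [Fintype W] [Fintype g.Site]
    {R₀ : ℝ} {H₀ : Prop} {𝔬 : B9Thm312Whole.Ops g B X Y Z W} {Dd Dds : B.Cfg → P → Module.End ℝ (X → ℝ)} {B₄ B₄' δ : ℝ} {U : B.Cfg}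
    (hG : GeoOK g) (hB₄ : 0 ≤ B₄) (hBB : B₄ ≤ B₄') {vZ : g.Site → ℝ} {hvZ : ∀ y, 0 < vZ y} (h : Letters313L2MZ 𝔬 Dd Dds R₀ H₀ B₄ δ vZ hvZ U) :
    Letters313L2MZ 𝔬 Dd Dds R₀ H₀ B₄' δ vZ hvZ U := by
  have hB₄' : 0 ≤ B₄' := hB₄.trans hBB
  have hl : ∀ y : g.Site, 0 ≤ g.len y := hG.lenle
  exact
    { dGDvd := fun ν => (h.dGDvd ν).mono fun y y' => mul_le_mul_of_nonneg_right hBB (Real.exp_nonneg _)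
      dGQsd := fun ν => (h.dGQsd ν).mono fun y y' =>
        mul_le_mul_of_nonneg_right (mul_le_mul_of_nonneg_right hBB (mul_nonneg (hvZ y').le (hl y'))) (Real.exp_nonneg _)
      rgdDd := fun μ => (h.rgdDd μ).mono fun y y' => mul_le_mul_of_nonneg_right hBB (Real.exp_nonneg _) }

/-- ★★ **THE RE-CUT BLOCK-L² LETTERS `vDRDG ∕ vGDRD` AT THE MEMBERS OF RECORD, AT THE G′ MODEL `GcoS … (GpY …)`** (module docstring): for every member above one threshold and every
`U` of the (3.35)∕(3.36) class in the regime (M₁, a₁): ‖1_{Δ(y)} D R D\*G₁ μ‖₂ ≤ B₄·(L^{j′}η∕Lʲη)·e^{−δ₃d}‖μ‖₂ and ‖1_{Δ(y)} G₁ D R D\* μ‖₂ ≤ B₄·(Lʲη∕L^{j′}η)·e^{−δ₃d}‖μ‖₂ for `(𝔬12 x)`'s letters,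
from the displayed (3.152) at `GcoS … (GpY …)` and the certificate's derived Theorem 3.1 ∕ (3.49) ∕ (3.46)₄ families at the same letter, by dag-n06-l's `vDRDG_of_ids3152 ∕ vGDRD_of_ids3152`.
[cite: Balaban1985BackgroundPropagators, Thm 3.13 p.426 + (3.152)–(3.153) p.426 + Thm 3.1 (3.42)∕(3.46) pp.397–398 + (3.49) p.399 + (3.25) p.394 + (3.35) p.396 + p.391; Balaban1984PropagatorsII, (2.52)–(2.56) pp.232–233 + Lemma 2.1 (2.60)–(2.61) p.234] -/
theorem vDRDG_vGDRD_of_pins (H : MemberY d ℓ hd hL b₀ b₁ Mstar → Prop)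
    (bI : ∀ x : MemberY d ℓ hd hL b₀ b₁ Mstar, FBondY x.toKIdx → IBondY x.toKIdx)
    (𝔬12 : ∀ x : MemberY d ℓ hd hL b₀ b₁ Mstar, B9Thm312Whole.Ops (geo9Y x) (bg9Y (Matrix (Fin N) (Fin N) ℂ) (specialUnitaryUnits (Fin N)) x)
      (XBK (TrIdx N) x.toKIdx) (XBK (TrIdx N) x.toKIdx) (XHK (TrIdx N) x.toKIdx) (XSK (TrIdx N) x.toKIdx))
    (hblk12 : ∀ x : MemberY d ℓ hd hL b₀ b₁ Mstar, (𝔬12 x).blk = blkBK x.toKIdx (bI x))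
    (hblkW12 : ∀ x : MemberY d ℓ hd hL b₀ b₁ Mstar, (𝔬12 x).blkW = blkSK x.toKIdx (sIK x.toKIdx (bI x)))
    (hDvco12 : ∀ (x : MemberY d ℓ hd hL b₀ b₁ Mstar) (U : (bg9Y (Matrix (Fin N) (Fin N) ℂ) (specialUnitaryUnits (Fin N)) x).Cfg),
      (𝔬12 x).Dv U = DvcoKH x.toKIdx (trBasis N) (bg9Y (Matrix (Fin N) (Fin N) ℂ) (specialUnitaryUnits (Fin N)) x) (fun U => U) U)
    (hDvsco12 : ∀ (x : MemberY d ℓ hd hL b₀ b₁ Mstar) (U : (bg9Y (Matrix (Fin N) (Fin N) ℂ) (specialUnitaryUnits (Fin N)) x).Cfg),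
      (𝔬12 x).Dvstar U = DvscoKH x.toKIdx (trBasis N) (bg9Y (Matrix (Fin N) (Fin N) ℂ) (specialUnitaryUnits (Fin N)) x) (fun U => U) U)
    (hRco12 : ∀ (x : MemberY d ℓ hd hL b₀ b₁ Mstar) (U : (bg9Y (Matrix (Fin N) (Fin N) ℂ) (specialUnitaryUnits (Fin N)) x).Cfg),
      (𝔬12 x).R U = RcoK x.toKIdx (trBasis N) (bg9Y (Matrix (Fin N) (Fin N) ℂ) (specialUnitaryUnits (Fin N)) x) (fun U => U) (parSymY x.toKIdx) (GpPhysY x.toKIdx (parSymY x.toKIdx)) U)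
    (q : PinPrims) (hq : q.OK) {c35 : ℝ} (hc35 : 0 < c35) {M₁ a₁ B31 δ31 CP δP rT σS δ₃ : ℝ} (B₄₀ : ℝ)
    (hB31 : 0 ≤ B31) (hCP : 0 ≤ CP) (hσS : 0 < σS) (hrTσ : 2 * σS ≤ rT) (hrT31 : rT ≤ δ31) (hrTP : rT ≤ δP)
    (hrT4 : rT ≤ δ46 d ℓ hd hL b₀ b₁ Mstar N c35 hc35) (hδ₃ : δ₃ ≤ (1 - 2 * q.αF) * rT - σS)
    -- Theorem 3.1 for G′ at the LATTICE letter (the certificate's `h31`, from `thm31GpMaj_of_t37_pairM`)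
    (h31 : ∀ x : MemberY d ℓ hd hL b₀ b₁ Mstar, M₁ ≤ (geo9Y x).M → ∀ α₀ : ℝ, 0 < α₀ → (geo9Y x).M * α₀ ≤ a₁ →
      ∀ U : (bg9Y (Matrix (Fin N) (Fin N) ℂ) (specialUnitaryUnits (Fin N)) x).Cfg, (bg9Y (Matrix (Fin N) (Fin N) ℂ) (specialUnitaryUnits (Fin N)) x).Reg335 c35 α₀ U →
        Thm31GpMaj (g := geo9Y x) (blkSK x.toKIdx (sIK x.toKIdx (bI x))) (blkBK x.toKIdx (bI x))
          (GcoS x.toKIdx (trBasis N) (bg9Y (Matrix (Fin N) (Fin N) ℂ) (specialUnitaryUnits (Fin N)) x) (fun U => U) (GpY x.toKIdx (parSymY x.toKIdx)) U)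
          (DvcoKH x.toKIdx (trBasis N) (bg9Y (Matrix (Fin N) (Fin N) ℂ) (specialUnitaryUnits (Fin N)) x) (fun U => U) U)
          (DvscoKH x.toKIdx (trBasis N) (bg9Y (Matrix (Fin N) (Fin N) ℂ) (specialUnitaryUnits (Fin N)) x) (fun U => U) U) 1 (H x) B31 δ31)
    -- (3.49) for P = I − R at the lattice letter (the certificate's `h49`, from `proj349Maj_of_t37_display348_rate`)
    (h49 : ∀ x : MemberY d ℓ hd hL b₀ b₁ Mstar, M₁ ≤ (geo9Y x).M → ∀ α₀ : ℝ, 0 < α₀ → (geo9Y x).M * α₀ ≤ a₁ →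
      ∀ U : (bg9Y (Matrix (Fin N) (Fin N) ℂ) (specialUnitaryUnits (Fin N)) x).Cfg, (bg9Y (Matrix (Fin N) (Fin N) ℂ) (specialUnitaryUnits (Fin N)) x).Reg335 c35 α₀ U →
        Proj349Maj (g := geo9Y x) (blkSK x.toKIdx (sIK x.toKIdx (bI x))) (blkBK x.toKIdx (bI x))
          (PcoK x.toKIdx (trBasis N) (bg9Y (Matrix (Fin N) (Fin N) ℂ) (specialUnitaryUnits (Fin N)) x) (fun U => U) (parSymY x.toKIdx) (GpY x.toKIdx (parSymY x.toKIdx)) U)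
          (DvcoKH x.toKIdx (trBasis N) (bg9Y (Matrix (Fin N) (Fin N) ℂ) (specialUnitaryUnits (Fin N)) x) (fun U => U) U)
          (DvscoKH x.toKIdx (trBasis N) (bg9Y (Matrix (Fin N) (Fin N) ℂ) (specialUnitaryUnits (Fin N)) x) (fun U => U) U) 1 (H x) CP δP)
    -- (3.46)₄ for DG′D\* at the lattice letter, CLOSED constants (the certificate's `h46`, dag-n06-w7 `blockBd_DvGcoSDvs_memberY_at`)
    (h46 : ∀ x : MemberY d ℓ hd hL b₀ b₁ Mstar, M₁ ≤ (geo9Y x).M → ∀ α₀ : ℝ, 0 < α₀ → (geo9Y x).M * α₀ ≤ a₁ →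
      ∀ U : (bg9Y (Matrix (Fin N) (Fin N) ℂ) (specialUnitaryUnits (Fin N)) x).Cfg, (bg9Y (Matrix (Fin N) (Fin N) ℂ) (specialUnitaryUnits (Fin N)) x).Reg335 c35 α₀ U →
        BlockBd (g := toB6 (geo9Y x) 1 (H x)) (𝔬12 x).blk (𝔬12 x).blk
          (DvcoKH x.toKIdx (trBasis N) (bg9Y (Matrix (Fin N) (Fin N) ℂ) (specialUnitaryUnits (Fin N)) x) (fun U => U) U ∘ₗ
            GcoS x.toKIdx (trBasis N) (bg9Y (Matrix (Fin N) (Fin N) ℂ) (specialUnitaryUnits (Fin N)) x) (fun U => U) (GpY x.toKIdx (parSymY x.toKIdx)) U ∘ₗ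
              DvscoKH x.toKIdx (trBasis N) (bg9Y (Matrix (Fin N) (Fin N) ℂ) (specialUnitaryUnits (Fin N)) x) (fun U => U) U)
          (fun (y y' : (geo9Y x).Site) => B46 d ℓ hd hL b₀ b₁ Mstar N c35 hc35 * Real.exp (-(δ46 d ℓ hd hL b₀ b₁ Mstar N c35 hc35 * (geo9Y x).dist y y'))))
    -- the DISPLAYED identity (3.152) at the G′ model `GcoS … (GpY …)` (which CARRIES print's η²: `GcoS … O U = (etaS²·cR39 b) • coordOpK …` — node00-def-Y LOCATED-152)
    (h152 : ∀ x : MemberY d ℓ hd hL b₀ b₁ Mstar, M₁ ≤ (geo9Y x).M → ∀ α₀ : ℝ, 0 < α₀ → (geo9Y x).M * α₀ ≤ a₁ →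
      ∀ U : (bg9Y (Matrix (Fin N) (Fin N) ℂ) (specialUnitaryUnits (Fin N)) x).Cfg, (bg9Y (Matrix (Fin N) (Fin N) ℂ) (specialUnitaryUnits (Fin N)) x).Reg335 c35 α₀ U →
        (bg9Y (Matrix (Fin N) (Fin N) ℂ) (specialUnitaryUnits (Fin N)) x).Reg336 c35 α₀ U →
          Ids3152 (𝔬12 x) (fun U => GcoS x.toKIdx (trBasis N) (bg9Y (Matrix (Fin N) (Fin N) ℂ) (specialUnitaryUnits (Fin N)) x) (fun U => U) (GpY x.toKIdx (parSymY x.toKIdx)) U) U) :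
    ∃ (Mc B₄ : ℝ), M₁ ≤ Mc ∧ B₄₀ ≤ B₄ ∧
      ∀ x : MemberY d ℓ hd hL b₀ b₁ Mstar, Mc ≤ (geo9Y x).M → ∀ α₀ : ℝ, 0 < α₀ → (geo9Y x).M * α₀ ≤ a₁ →
        ∀ U : (bg9Y (Matrix (Fin N) (Fin N) ℂ) (specialUnitaryUnits (Fin N)) x).Cfg, (bg9Y (Matrix (Fin N) (Fin N) ℂ) (specialUnitaryUnits (Fin N)) x).Reg335 c35 α₀ U →
          (bg9Y (Matrix (Fin N) (Fin N) ℂ) (specialUnitaryUnits (Fin N)) x).Reg336 c35 α₀ U →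
            BlockBd (g := toB6 (geo9Y x) 1 (H x)) (𝔬12 x).blk (𝔬12 x).blk ((𝔬12 x).Dv U ∘ₗ (𝔬12 x).R U ∘ₗ (𝔬12 x).Dvstar U ∘ₗ (𝔬12 x).G1 U)
                (fun (y y' : (geo9Y x).Site) => B₄ * (((geo9Y x).len y)⁻¹ * (geo9Y x).len y') * Real.exp (-(δ₃ * (geo9Y x).dist y y'))) ∧
              BlockBd (g := toB6 (geo9Y x) 1 (H x)) (𝔬12 x).blk (𝔬12 x).blk ((𝔬12 x).G1 U ∘ₗ (𝔬12 x).Dv U ∘ₗ (𝔬12 x).R U ∘ₗ (𝔬12 x).Dvstar U)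
                (fun (y y' : (geo9Y x).Site) => B₄ * ((geo9Y x).len y * ((geo9Y x).len y')⁻¹) * Real.exp (-(δ₃ * (geo9Y x).dist y y'))) := by
  have hN0 : 0 < N := Nat.pos_of_ne_zero (NeZero.ne N)
  have hc0 : 0 < cR39 (trBasis N) := cR39_trBasis_pos hN0
  have hϱ : 0 ≤ (cR39 (trBasis N))⁻¹ := inv_nonneg.mpr hc0.le
  have hrT0 : 0 < rT := by linarith only [hσS, hrTσ]
  have h2α : 0 < 1 - 2 * q.α := by linarith only [hq.α_lt]
  -- the member facts at the rate rT (exponent α := q.α inside `exp261`, transfer exponent α_F) and [4] (2.61) at the rate σS, above ONE threshold each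
  obtain ⟨Mth, -, hfacts, -⟩ := lemma21Pack_geo9Y (d := d) (ℓ := ℓ) (hd := hd) (hL := hL) (b₀ := b₀) (b₁ := b₁) (Mstar := Mstar) H hq.α_pos hq.α_lt
    (div_pos hrT0 h2α) hq.αF_pos (by linarith only [hq.αF_lt])
  have hrate : (1 - 2 * q.α) * (rT / (1 - 2 * q.α)) = rT := mul_div_cancel₀ rT h2α.ne'
  obtain ⟨ML, c₁, hrow⟩ := rowSum261_geo9Y (d := d) (ℓ := ℓ) (hd := hd) (hL := hL) (b₀ := b₀) (b₁ := b₁) (Mstar := Mstar) σS hσS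
  set c : ℝ := max c₁ 0 with hcdef
  have hc : 0 ≤ c := le_max_right _ _
  set L₀ : ℝ := ((ℓ + 1 : ℕ) : ℝ) with hL₀
  have hBD : 0 ≤ B46 d ℓ hd hL b₀ b₁ Mstar N c35 hc35 := (B46_pos d ℓ hd hL b₀ b₁ Mstar N c35 hc35).le
  set B₄ : ℝ := max B₄₀ ((cR39 (trBasis N))⁻¹ * L₀ * (B46 d ℓ hd hL b₀ b₁ Mstar N c35 hc35 + CP * L₀ * B31 * c)) with hB₄def
  have hL₀0 : 0 ≤ L₀ := by rw [hL₀]; positivity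
  have hB₄b : (cR39 (trBasis N))⁻¹ * L₀ * (B46 d ℓ hd hL b₀ b₁ Mstar N c35 hc35 + CP * L₀ * B31 * c) ≤ B₄ := le_max_right _ _
  -- the rate bookkeeping of `vDRDG_of_ids3152` at (δ := rT, α := q.αF, σ := σS)
  have hαδ : 0 ≤ q.αF * rT := mul_nonneg hq.αF_pos.le hrT0.le
  have hαF2 : q.αF * rT ≤ rT / 2 := by have := hq.αF_lt; nlinarith [hrT0.le, this]
  have hbud : 0 ≤ rT - σS - q.αF * rT := by linarith only [hrTσ, hαF2, hrT0.le]
  have hδD : rT - σS - q.αF * rT ≤ δ46 d ℓ hd hL b₀ b₁ Mstar N c35 hc35 := by linarith only [hrT4, hσS.le, hαδ]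
  have hδ₄ : δ₃ ≤ rT - σS - 2 * (q.αF * rT) := by linarith only [hδ₃]
  refine ⟨max M₁ (max Mth ML), B₄, le_max_left _ _, le_max_left _ _, fun x hM α₀ hα ha U hU hU' => ?_⟩
  have hM1x : M₁ ≤ (geo9Y x).M := (le_max_left _ _).trans hM
  have hMthx : Mth ≤ (geo9Y x).M := ((le_max_left _ _).trans (le_max_right _ _)).trans hM
  have hMLx : ML ≤ (geo9Y x).M := ((le_max_right _ _).trans (le_max_right _ _)).trans hM
  have hG : GeoOK (geo9Y x) := ⟨geo9Y_dist_triangle x, geo9Y_dist_comm x, geo9K_dist_nonneg x.toKIdx, geo9Y_len_pos x⟩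
  have hF := hfacts x hMthx
  rw [hrate] at hF
  have hrowx : RowSum (toB6 (geo9Y x) 1 (H x)) σS c := fun y => (hrow x hMLx y).trans (le_max_left _ _)
  have hUu : ∀ μ z, ((U μ z : (Matrix (Fin N) (Fin N) ℂ)ˣ) : Matrix (Fin N) (Fin N) ℂ) ∈ unitary (Matrix (Fin N) (Fin N) ℂ) :=
    fun μ z => specialUnitaryUnits_le_unitaryUnits (hU.1.1 μ z)
  -- Theorem 3.1 read for (𝔬12 x)'s block maps and divergence letters (NO units transfer: `GcoS` carries η², def-Y LOCATED-152)
  have h31p : Thm31GpMaj (g := geo9Y x) (𝔬12 x).blkW (𝔬12 x).blk (GcoS x.toKIdx (trBasis N) (bg9Y (Matrix (Fin N) (Fin N) ℂ) (specialUnitaryUnits (Fin N)) x) (fun U => U) (GpY x.toKIdx (parSymY x.toKIdx)) U) ((𝔬12 x).Dv U) ((𝔬12 x).Dvstar U) 1 (H x) B31 δ31 := by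
    rw [hblkW12 x, hblk12 x, hDvco12 x U, hDvsco12 x U]; exact h31 x hM1x α₀ hα ha U hU
  -- (3.49) read for (𝔬12 x)'s letters
  have h49p : Proj349Maj (g := geo9Y x) (𝔬12 x).blkW (𝔬12 x).blk
      (PcoK x.toKIdx (trBasis N) (bg9Y (Matrix (Fin N) (Fin N) ℂ) (specialUnitaryUnits (Fin N)) x) (fun U => U) (parSymY x.toKIdx) (GpY x.toKIdx (parSymY x.toKIdx)) U)
      ((𝔬12 x).Dv U) ((𝔬12 x).Dvstar U) 1 (H x) CP δP := by
    rw [hblkW12 x, hblk12 x, hDvco12 x U, hDvsco12 x U]; exact h49 x hM1x α₀ hα ha U hU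
  -- (3.46)₄ read for (𝔬12 x)'s divergence letters
  have h46p : BlockBd (g := toB6 (geo9Y x) 1 (H x)) (𝔬12 x).blk (𝔬12 x).blk ((𝔬12 x).Dv U ∘ₗ GcoS x.toKIdx (trBasis N) (bg9Y (Matrix (Fin N) (Fin N) ℂ) (specialUnitaryUnits (Fin N)) x) (fun U => U) (GpY x.toKIdx (parSymY x.toKIdx)) U ∘ₗ (𝔬12 x).Dvstar U)
      (fun (y y' : (geo9Y x).Site) => B46 d ℓ hd hL b₀ b₁ Mstar N c35 hc35 * Real.exp (-(δ46 d ℓ hd hL b₀ b₁ Mstar N c35 hc35 * (geo9Y x).dist y y'))) := by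
    rw [hDvco12 x U, hDvsco12 x U]; exact h46 x hM1x α₀ hα ha U hU
  -- R = ϱ(I − P) at the models (R is degree-0 homogeneous in G′: `rcoK_GpPhysY`)
  have hR : (𝔬12 x).R U = (cR39 (trBasis N))⁻¹ • (LinearMap.id -
      PcoK x.toKIdx (trBasis N) (bg9Y (Matrix (Fin N) (Fin N) ℂ) (specialUnitaryUnits (Fin N)) x) (fun U => U) (parSymY x.toKIdx) (GpY x.toKIdx (parSymY x.toKIdx)) U) := by
    rw [hRco12 x U, rcoK_GpPhysY, rcoK_eq]
  -- the transposition letters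
  have hGsym := isTransposePair_GcoS_trBasis x.toKIdx (bg9Y (Matrix (Fin N) (Fin N) ℂ) (specialUnitaryUnits (Fin N)) x) (fun U => U)
    (GpY x.toKIdx (parSymY x.toKIdx)) U (GpY_isSymmTr x.toKIdx (parSymY x.toKIdx) U (symm0_parSymY x.toKIdx specialUnitaryUnits_le_unitaryUnits hU.1.1))
  have hGpT : IsTransposePair (GcoS x.toKIdx (trBasis N) (bg9Y (Matrix (Fin N) (Fin N) ℂ) (specialUnitaryUnits (Fin N)) x) (fun U => U) (GpY x.toKIdx (parSymY x.toKIdx)) U) (GcoS x.toKIdx (trBasis N) (bg9Y (Matrix (Fin N) (Fin N) ℂ) (specialUnitaryUnits (Fin N)) x) (fun U => U) (GpY x.toKIdx (parSymY x.toKIdx)) U) := hGsym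
  have hDvT : IsTransposePair ((𝔬12 x).Dv U) ((𝔬12 x).Dvstar U) := by
    rw [hDvco12 x U, hDvsco12 x U]
    exact isTransposePair_DvcoKH_DvscoKH x.toKIdx (bg9Y (Matrix (Fin N) (Fin N) ℂ) (specialUnitaryUnits (Fin N)) x) (fun U => U) U hUu
  have hRsym := isTransposePair_RcoK x.toKIdx (bg9Y (Matrix (Fin N) (Fin N) ℂ) (specialUnitaryUnits (Fin N)) x) (fun U => U) U
    specialUnitaryUnits_le_unitaryUnits hU.1.1
  have hPeq : PcoK x.toKIdx (trBasis N) (bg9Y (Matrix (Fin N) (Fin N) ℂ) (specialUnitaryUnits (Fin N)) x) (fun U => U) (parSymY x.toKIdx)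
      (GpY x.toKIdx (parSymY x.toKIdx)) U = 1 - (cR39 (trBasis N)) •
        RcoK x.toKIdx (trBasis N) (bg9Y (Matrix (Fin N) (Fin N) ℂ) (specialUnitaryUnits (Fin N)) x) (fun U => U) (parSymY x.toKIdx) (GpY x.toKIdx (parSymY x.toKIdx)) U := by
    rw [rcoK_eq, smul_smul, mul_inv_cancel₀ hc0.ne', one_smul, Module.End.one_eq_id, sub_sub_cancel]
  have hPT : IsTransposePair
      (PcoK x.toKIdx (trBasis N) (bg9Y (Matrix (Fin N) (Fin N) ℂ) (specialUnitaryUnits (Fin N)) x) (fun U => U) (parSymY x.toKIdx) (GpY x.toKIdx (parSymY x.toKIdx)) U)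
      (PcoK x.toKIdx (trBasis N) (bg9Y (Matrix (Fin N) (Fin N) ℂ) (specialUnitaryUnits (Fin N)) x) (fun U => U) (parSymY x.toKIdx) (GpY x.toKIdx (parSymY x.toKIdx)) U) := by
    rw [hPeq]; exact isTransposePair_one.sub (isTransposePair_smul hRsym _)
  have hI := h152 x hM1x α₀ hα ha U hU hU'
  exact ⟨vDRDG_of_ids3152 (P := fun U => PcoK x.toKIdx (trBasis N) (bg9Y (Matrix (Fin N) (Fin N) ℂ) (specialUnitaryUnits (Fin N)) x) (fun U => U) (parSymY x.toKIdx)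
        (GpY x.toKIdx (parSymY x.toKIdx)) U) hG hF hrowx h31p h49p h46p hR hI hGpT hDvT hPT hϱ hB31 hCP hBD hc hσS.le hαδ hrT31 hrTP hbud hδD
        hB₄b hδ₄,
      vGDRD_of_ids3152 (P := fun U => PcoK x.toKIdx (trBasis N) (bg9Y (Matrix (Fin N) (Fin N) ℂ) (specialUnitaryUnits (Fin N)) x) (fun U => U) (parSymY x.toKIdx)
        (GpY x.toKIdx (parSymY x.toKIdx)) U) hG hF hrowx h31p h49p h46p hR hI hGpT hDvT hPT hϱ hB31 hCP hBD hc hσS.le hαδ hrT31 hrTP hbud hδD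
        hB₄b hδ₄⟩

end Summit.QuantumFields.YangMills.BalabanUVNodes.N06CutL2LettersAtPinsPhys

end
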